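import Summits.CriticalPhenomena.PercolationContinuityZ3.Theorems.PercNearOneGluingNoHeavyQuantPairFlowCertificate
import HarnessLib

/-!
# QUANT lane R8, T-DEC: THE PAIR-FLOW CERTIFICATE, part 3 — CLOSED-FORM PAIR COSTS: the sibling step at the TRUE floor, for every width and
# arbitrary gates / means / sub-trees, from ONE explicit inequality per pair of siblings (`h(a)·h(b) ≤ h(a) + h(b)`), GIVEN the oracle

builds on p205010 (kernel theorem, internal audit signed; external expert review pending)

Support file (`--supports stmt-CriticalPhenomena-4575`), QUANT lane seat prim-quant-census-1 (gen 27), rung R8 of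
`run/shared/lean/prim/quant/LADDER.md`; memo `run/shared/lean/prim/quant/prim-quant-census-1/g27/PAIRFLOW-G27.md` §3.  Theorems only, standard axioms,
no sorries.  A COROLLARY of ✓ `…QuantPairFlowCertificate` (`sdec_flaw_of_pairFlow`): the flow is produced by 2-CYCLES.

THE 2-CYCLE SOLUTION (memo §3).  Loss factors `g_{a,b} = q_b((1−q_b)m_b − q_a m_a)/(q_a m_a)` (`= τ_{a,b}/s_{a,b}`; `0 ≤ g`, `g_{a,b}g_{b,a} < 1` by pairwise
absorbability).  A 2-cycle on `{a,b}` with flows `s_{a,b} = α`, `s_{b,a} = β` injects `ν_a = β − g_{a,b}α` at `a` and `ν_b = α − g_{b,a}β` at `b`, and EVERY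
nonnegative pair of injections is realisable: `α = (ν_b + g_{b,a}ν_a)/(1 − g_{a,b}g_{b,a})`, `β = (ν_a + g_{a,b}ν_b)/(1 − g_{a,b}g_{b,a})`, with pair coverage
`α + β = ν_a/c_{a,b} + ν_b/c_{b,a}`, COSTS `c_{a,b} = (1 − g_{a,b}g_{b,a})/(1 + g_{b,a}) ∈ (0,1]`.  The node balance (N_a) of part 2 asks the injections AT
`a` to sum to `1`; the PROPORTIONAL RULE `ν^a_{ab} = c_{a,b}/h(a)`, `h(a) = Σ_{b≠a} c_{a,b}`, does that, and then the coverage of the pair `{a,b}` is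
`1/h(a) + 1/h(b)`, which is `≥ 1` iff `h(a)·h(b) ≤ h(a) + h(b)`.  Equal means: `c_{a,b} = q_b(q_a+q_b)(2−q_a−q_b)/(q_a(1−q_a−q_b)+q_b)`; identical siblings:
`h ≡ 2(k−1)q`, so the condition is `(k−1)q ≤ 1` (✓ p505337); width 3: `c ≤ 1` gives `h ≤ 2` always (✓ p507376 / `…CyclicBoostGeneral` for equal means);
the weaker test `max_a h(a) ≤ 2` (the HALF rule) already STRICTLY CONTAINS census-1 g26's conjectured `Σq − min q ≤ 1` (k = 4: 152 ⊋ 93 of 200 groups).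

* **`sdec_flaw_of_pairCosts`**: part 2's hypotheses with the flow replaced by the closed-form test `h a * h b ≤ h a + h b` (`a ≠ b`), the functions
  `g`, `c`, `h` being passed with their defining equations (instantiate with the formulas and `fun _ _ => rfl`).
* **`sdec_flaw_of_pairCosts_le_two`**: the same from `h a ≤ 2` for every `a`.

HONEST STATUS.  A k-general sub-family of the open core with an explicit membership test; `SiblingStep` ⟺ `GateStepN`, `UPartStep`, `LightResidDECOracle`,
`FarTreeRow` remain OPEN; RATE class (log\*) and the honest sentence of `run/shared/lean/prim/quant/README.md` unchanged.  [this work]; nothing here is cited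
as a published result.  The gluing rows served [cite: KozmaNitzan2024, Conjecture 3 (p. 15)]; product measure [cite: Grimmett1999, §1.3 p. 10].
-/

noncomputable section

open scoped BigOperators

namespace Summit.CriticalPhenomena.PercolationContinuityZ3.Theorems
namespace Quant
namespace LawDec

open Finset

/-- **THE PAIR-FLOW CERTIFICATE FROM CLOSED-FORM PAIR COSTS (every width; SDEC form, given the oracle).**  Tree-built siblings `L` (`2 ≤ |L|`) at
floor `x`, pairwise absorbability, pair means `≥ fmean L`, the floor condition, and — with the loss factors `g`, costs `c` and node totals `h` of the module
docstring, passed with their defining equations — `h a · h b ≤ h a + h b` for all `a ≠ b`; the oracle below `fgates L` ⟹ `SDEC x (ftop L) (flaw L)`.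
[this work] -/
theorem sdec_flaw_of_pairCosts {x : ℝ} (hx0 : 0 < x) (hx1 : x < 1) (L : List Sib)
    (hL : ∀ t ∈ L, t.TreeOK x) (hn : 2 ≤ L.length)
    (hO : ∀ (x' : ℝ) (n' M' : ℕ) (μ' : ℕ → ℝ), n' < fgates L → TreeBuiltN x' n' M' μ' → SDEC x' M' μ')
    (hleg : ∀ d j : Fin L.length, d ≠ j →
      (L.get j).q * (L.get j).mean + (L.get d).q * (L.get d).mean ≤ (L.get j).mean)
    (hpair : ∀ a b : Fin L.length, a ≠ b → fmean L ≤ (L.get a).mean + (L.get b).mean)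
    (hfl : ∀ i : Fin L.length, x * ∑ l, (L.get l).mean ≤ fmean L * (L.get i).x₁)
    (g c : Fin L.length → Fin L.length → ℝ) (h : Fin L.length → ℝ)
    (hg : ∀ a b, g a b = (L.get b).q * ((1 - (L.get b).q) * (L.get b).mean - (L.get a).q * (L.get a).mean)
      / ((L.get a).q * (L.get a).mean))
    (hc : ∀ a b, c a b = (1 - g a b * g b a) / (1 + g b a))
    (hh : ∀ a, h a = ∑ b ∈ Finset.univ.erase a, c a b)
    (hcost : ∀ a b : Fin L.length, a ≠ b → 0 < h a → 0 < h b → h a * h b ≤ h a + h b) :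
    SDEC x (ftop L) (flaw L) := by
  classical
  have hget : ∀ i : Fin L.length, (L.get i).TreeOK x := fun i => hL _ (List.get_mem L i)
  set q : Fin L.length → ℝ := fun i => (L.get i).q with hqdef
  set m : Fin L.length → ℝ := fun i => (L.get i).mean with hmdef
  have hq0 : ∀ i, 0 < q i := fun i => (hget i).1
  have hq1 : ∀ i, q i < 1 := fun i => (hget i).2.1
  have hm0 : ∀ i, 0 < m i := fun i => (L.get i).mean_pos (hget i)
  -- the loss factors
  have hgf : ∀ a b, g a b = q b * ((1 - q b) * m b - q a * m a) / (q a * m a) := hg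
  have hg0 : ∀ a b, a ≠ b → 0 ≤ g a b := by
    intro a b hab
    rw [hgf]
    have h1 : 0 ≤ (1 - q b) * m b - q a * m a := by
      have := hleg a b hab
      show 0 ≤ (1 - (L.get b).q) * (L.get b).mean - (L.get a).q * (L.get a).mean; linarith
    exact div_nonneg (mul_nonneg (hq0 b).le h1) (mul_pos (hq0 a) (hm0 a)).le
  have hgg : ∀ a b, a ≠ b → g a b * g b a < 1 := by
    intro a b hab
    rw [hgf, hgf]
    have hA0 : 0 ≤ (1 - q b) * m b - q a * m a := by
      have := hleg a b hab
      show 0 ≤ (1 - (L.get b).q) * (L.get b).mean - (L.get a).q * (L.get a).mean; linarith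
    have hB0 : 0 ≤ (1 - q a) * m a - q b * m b := by
      have := hleg b a hab.symm
      show 0 ≤ (1 - (L.get a).q) * (L.get a).mean - (L.get b).q * (L.get b).mean; linarith
    have hA1 : (1 - q b) * m b - q a * m a < m b := by nlinarith [hq0 b, hm0 b, hq0 a, hm0 a]
    have hB1 : (1 - q a) * m a - q b * m b ≤ m a := by nlinarith [hq0 b, hm0 b, hq0 a, hm0 a]
    have e : q b * ((1 - q b) * m b - q a * m a) / (q a * m a) * (q a * ((1 - q a) * m a - q b * m b) / (q b * m b))
        = (((1 - q b) * m b - q a * m a) * ((1 - q a) * m a - q b * m b)) / (m a * m b) := by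
      rw [div_mul_div_comm, div_eq_div_iff (mul_ne_zero (mul_ne_zero (hq0 a).ne' (hm0 a).ne') (mul_ne_zero (hq0 b).ne' (hm0 b).ne'))
        (mul_ne_zero (hm0 a).ne' (hm0 b).ne')]
      ring
    rw [e, div_lt_one (mul_pos (hm0 a) (hm0 b))]
    calc ((1 - q b) * m b - q a * m a) * ((1 - q a) * m a - q b * m b)
        ≤ ((1 - q b) * m b - q a * m a) * m a := mul_le_mul_of_nonneg_left hB1 hA0
      _ < m b * m a := mul_lt_mul_of_pos_right hA1 (hm0 a)
      _ = m a * m b := mul_comm _ _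
  have hD0 : ∀ a b, a ≠ b → 0 < 1 - g a b * g b a := fun a b hab => by linarith [hgg a b hab]
  have hc0 : ∀ a b, a ≠ b → 0 < c a b := by
    intro a b hab
    rw [hc]
    exact div_pos (hD0 a b hab) (by linarith [hg0 b a hab.symm])
  have hh0 : ∀ a, 0 < h a := by
    intro a
    rw [hh]
    obtain ⟨b, hb⟩ : ∃ b : Fin L.length, b ≠ a := by
      by_cases ha : (a : ℕ) = 0
      · exact ⟨⟨1, by omega⟩, fun e => by have := congrArg Fin.val e; simp at this; omega⟩
      · exact ⟨⟨0, by omega⟩, fun e => by have := congrArg Fin.val e; simp at this; omega⟩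
    exact Finset.sum_pos' (fun i hi => (hc0 a i (Finset.ne_of_mem_erase hi).symm).le)
      ⟨b, Finset.mem_erase.2 ⟨hb, Finset.mem_univ b⟩, hc0 a b hb.symm⟩
  -- the proportional injections and the 2-cycle flows
  set ν : Fin L.length → Fin L.length → ℝ := fun a b => c a b / h a with hν
  set s : Fin L.length → Fin L.length → ℝ := fun a b => (ν b a + g b a * ν a b) / (1 - g a b * g b a) with hs
  have hν0 : ∀ a b, a ≠ b → 0 ≤ ν a b := fun a b hab => div_nonneg (hc0 a b hab).le (hh0 a).le
  have hs0' : ∀ a b, a ≠ b → 0 ≤ s a b := fun a b hab =>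
    div_nonneg (add_nonneg (hν0 b a hab.symm) (mul_nonneg (hg0 b a hab.symm) (hν0 a b hab))) (hD0 a b hab).le
  -- the flow handed to part 2 (zero on the diagonal)
  set s' : Fin L.length → Fin L.length → ℝ := fun a b => if a = b then 0 else s a b with hs'
  have hs'0 : ∀ a b, 0 ≤ s' a b := by
    intro a b; show 0 ≤ (if a = b then 0 else s a b)
    split_ifs with hab
    · exact le_rfl
    · exact hs0' a b hab
  -- pair coverage
  have hcov : ∀ a b : Fin L.length, a ≠ b → 1 ≤ s' a b + s' b a := by
    intro a b hab
    show 1 ≤ (if a = b then 0 else s a b) + (if b = a then 0 else s b a)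
    rw [if_neg hab, if_neg hab.symm]
    have hDab := hD0 a b hab
    have h1 : (1 + g b a) ≠ 0 := by linarith [hg0 b a hab.symm]
    have h2 : (1 + g a b) ≠ 0 := by linarith [hg0 a b hab]
    have eA : ν a b * (1 + g b a) = (1 - g a b * g b a) / h a := by
      show c a b / h a * (1 + g b a) = _
      rw [div_mul_eq_mul_div, hc, div_mul_cancel₀ _ h1]
    have eB : ν b a * (1 + g a b) = (1 - g a b * g b a) / h b := by
      show c b a / h b * (1 + g a b) = _
      rw [div_mul_eq_mul_div, hc, div_mul_cancel₀ _ h2, mul_comm (g b a) (g a b)]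
    have e1 : s a b + s b a = (ν a b * (1 + g b a) + ν b a * (1 + g a b)) / (1 - g a b * g b a) := by
      show (ν b a + g b a * ν a b) / (1 - g a b * g b a) + (ν a b + g a b * ν b a) / (1 - g b a * g a b) = _
      rw [mul_comm (g b a) (g a b), ← add_div]
      congr 1; ring
    have ha := hh0 a; have hb := hh0 b
    rw [e1, eA, eB, div_add_div _ _ ha.ne' hb.ne', div_div, le_div_iff₀ (by positivity), one_mul]
    have := hcost a b hab ha hb
    nlinarith [mul_le_mul_of_nonneg_left this hDab.le]
  -- node balance
  have hnode : ∀ a : Fin L.length,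
      (L.get a).q * (L.get a).mean * ∑ d ∈ Finset.univ.erase a, s' d a
        - ∑ j ∈ Finset.univ.erase a, s' a j * ((L.get j).q * ((1 - (L.get j).q) * (L.get j).mean - (L.get a).q * (L.get a).mean))
        = (L.get a).q * (L.get a).mean := by
    intro a
    have hqm : 0 < q a * m a := mul_pos (hq0 a) (hm0 a)
    -- `q_j((1−q_j)m_j − q_a m_a) = g a j · q_a m_a`
    have e1 : ∀ j ∈ Finset.univ.erase a,
        s' a j * ((L.get j).q * ((1 - (L.get j).q) * (L.get j).mean - (L.get a).q * (L.get a).mean))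
        = q a * m a * (g a j * s' a j) := by
      intro j _
      show s' a j * (q j * ((1 - q j) * m j - q a * m a)) = q a * m a * (g a j * s' a j)
      have e : q a * m a * (q j * ((1 - q j) * m j - q a * m a) / (q a * m a) * s' a j)
          = (q j * ((1 - q j) * m j - q a * m a)) * s' a j := by
        rw [div_mul_eq_mul_div, ← mul_div_assoc, mul_div_cancel_left₀ _ hqm.ne']
      rw [hgf, e]
      ring
    rw [Finset.sum_congr rfl e1, ← Finset.mul_sum]
    show q a * m a * ∑ d ∈ Finset.univ.erase a, s' d a - q a * m a * ∑ j ∈ Finset.univ.erase a, g a j * s' a j = q a * m a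
    rw [← mul_sub, ← Finset.sum_sub_distrib]
    -- per pair: `s' b a − g a b · s' a b = ν a b`
    have e2 : ∀ b ∈ Finset.univ.erase a, s' b a - g a b * s' a b = ν a b := by
      intro b hb
      have hab : a ≠ b := (Finset.ne_of_mem_erase hb).symm
      show (if b = a then 0 else s b a) - g a b * (if a = b then 0 else s a b) = ν a b
      rw [if_neg hab.symm, if_neg hab]
      show (ν a b + g a b * ν b a) / (1 - g b a * g a b) - g a b * ((ν b a + g b a * ν a b) / (1 - g a b * g b a)) = ν a b
      rw [mul_comm (g b a) (g a b)]
      have e : (ν a b + g a b * ν b a) / (1 - g a b * g b a) - g a b * ((ν b a + g b a * ν a b) / (1 - g a b * g b a))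
          = (ν a b * (1 - g a b * g b a)) / (1 - g a b * g b a) := by ring
      rw [e, mul_div_assoc, div_self (hD0 a b hab).ne', mul_one]
    rw [Finset.sum_congr rfl e2]
    -- `Σ_b ν a b = 1`
    have e3 : ∑ b ∈ Finset.univ.erase a, ν a b = 1 := by
      show ∑ b ∈ Finset.univ.erase a, c a b / h a = 1
      rw [← Finset.sum_div, ← hh, div_self (hh0 a).ne']
    rw [e3, mul_one]
  exact sdec_flaw_of_pairFlow hx0 hx1 L hL hn hO hleg hpair hfl s' hs'0 hcov hnode

/-- **THE HALF RULE**: as `sdec_flaw_of_pairCosts`, from `h a ≤ 2` for every `a` (then `h a·h b ≤ h a + h b`, since `0 < h ≤ 2` gives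
`(h a − 1)(h b − 1) ≤ 1`). [this work] -/
theorem sdec_flaw_of_pairCosts_le_two {x : ℝ} (hx0 : 0 < x) (hx1 : x < 1) (L : List Sib)
    (hL : ∀ t ∈ L, t.TreeOK x) (hn : 2 ≤ L.length)
    (hO : ∀ (x' : ℝ) (n' M' : ℕ) (μ' : ℕ → ℝ), n' < fgates L → TreeBuiltN x' n' M' μ' → SDEC x' M' μ')
    (hleg : ∀ d j : Fin L.length, d ≠ j →
      (L.get j).q * (L.get j).mean + (L.get d).q * (L.get d).mean ≤ (L.get j).mean)
    (hpair : ∀ a b : Fin L.length, a ≠ b → fmean L ≤ (L.get a).mean + (L.get b).mean)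
    (hfl : ∀ i : Fin L.length, x * ∑ l, (L.get l).mean ≤ fmean L * (L.get i).x₁)
    (g c : Fin L.length → Fin L.length → ℝ) (h : Fin L.length → ℝ)
    (hg : ∀ a b, g a b = (L.get b).q * ((1 - (L.get b).q) * (L.get b).mean - (L.get a).q * (L.get a).mean)
      / ((L.get a).q * (L.get a).mean))
    (hc : ∀ a b, c a b = (1 - g a b * g b a) / (1 + g b a))
    (hh : ∀ a, h a = ∑ b ∈ Finset.univ.erase a, c a b)
    (hH : ∀ a : Fin L.length, h a ≤ 2) :
    SDEC x (ftop L) (flaw L) := by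
  refine sdec_flaw_of_pairCosts hx0 hx1 L hL hn hO hleg hpair hfl g c h hg hc hh (fun a b _ ha0 hb0 => ?_)
  have ha := hH a; have hb := hH b
  rcases le_or_gt 1 (h a) with ha1 | ha1 <;> rcases le_or_gt 1 (h b) with hb1 | hb1
  · nlinarith [mul_nonneg (sub_nonneg.2 ha) (sub_nonneg.2 hb1)]
  · nlinarith [mul_nonneg ha0.le (sub_nonneg.2 hb1.le)]
  · nlinarith [mul_nonneg hb0.le (sub_nonneg.2 ha1.le)]
  · nlinarith [mul_nonneg ha0.le (sub_nonneg.2 hb1.le)]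

end LawDec
end Quant
end Summit.CriticalPhenomena.PercolationContinuityZ3.Theorems
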